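import Summits.HodgeConjecture.CorCM.MumfordTateRankTrivialEndomorphisms
import Summits.HodgeConjecture.CorCM.MumfordTateRankTypeTwoLefschetz
import Summits.HodgeConjecture.CorCM.MumfordTateRankThree
import Summits.HodgeConjecture.CorCM.MumfordTateRankSevenQuaternionConverse
import Literature.AlgebraicGeometry.HodgeTheory.RealMultiplicationMumfordTateRank
import Literature.AlgebraicGeometry.HodgeTheory.SimpleAbelianSurfacePowersHodgeClasses
import Literature.AlgebraicGeometry.HodgeTheory.QuaternionMinimalPowersHodgeClasses
import Literature.AlgebraicGeometry.ComplexMultiplication.FieldOfDegreeTwoDimIsotypic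
import HarnessLib

/-!
# The Mumford–Tate rank of a simple complex abelian surface: `t ∈ {3, 4, 7, 11}`

Sub-problem `CorCM` of `HodgeConjecture` (cell `pub-hodgecm2`, count-neutral Mumford–Tate-rank lane of seat `b27`; theorems only,
no new definition, no named fact; nothing here uses or asserts `HC_CM`).  For a SIMPLE complex abelian surface `B`,
`t(B) = dim MT(H¹B)` is read off the endomorphism algebra (Moonen–Zarhin §2 (2.2): the four types I(1), I(2), II(1), IV(2,1);
the tree's `HodgeTheory/SimpleAbelianSurfacePowersHodgeClasses` supplies `dim_ℚ End⁰B ∈ {1, 2, 4}`, «quadratic ⟹ real quadratic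
field», «non-commutative of dimension 4 ⟹ quaternion algebra over ℚ»):

* `dim_ℚ End⁰B = 4`, commutative (a quartic CM field, type IV(2,1)): `B` is of CM type and **`t = 3`** (`CorCM/MumfordTateRankThree`);
* `dim_ℚ End⁰B = 4`, non-commutative (indefinite quaternion algebra, type II(1); type III(1) is impossible, Shimura): **`t = 4`**
  (`t ≤ 1·3 + 1`, `CorCM/MumfordTateRankTypeTwoLefschetz`; `t ≥ 4`, not CM);
* `dim_ℚ End⁰B = 2` (real quadratic field, type I(2)): **`t = 7`** (Ribet, `HodgeTheory/RealMultiplicationMumfordTateRank`);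
* `End⁰B = ℚ` (type I(1)): **`t ∈ {7, 11}`** (`CorCM/MumfordTateRankTrivialEndomorphisms`; in truth `t = 11`, `Hg = Sp₄` — the
  exclusion of `7` is not claimed here).

Hence **`t(B) ∈ {3, 4, 7, 11}`** (`mtRank_hodge_one_mem_of_isSimple_surface`), **`B` is of CM type iff `t = 3`**, and
**`End⁰B` is non-commutative iff `t = 4`**.

## References
* [MoonenZarhin1999LowDim] B. Moonen, Yu. G. Zarhin, *Hodge classes on abelian varieties of low dimension*, Math. Ann. 315 (1999), §2 (2.2).
* [Ribet1983] K. A. Ribet, *Hodge classes on certain types of abelian varieties*, Amer. J. Math. 105 (1983), Thm. 0–1.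
* [MumfordAV1970] D. Mumford, *Abelian Varieties* (1970), §19 Cor. 2, §21.
-/

noncomputable section

namespace Summit.HodgeConjecture.CorCM

open scoped TensorProduct
open CategoryTheory CategoryTheory.Limits Module NumberField
open Literature.AlgebraicGeometry.Motives
open Literature.AlgebraicGeometry.Motives.AbelianVariety
open Literature.AlgebraicGeometry.Motives.HodgeStructure
open Literature.AlgebraicGeometry.HodgeTheory
open Literature.AlgebraicGeometry.ComplexMultiplication (bettiRep EndField EndField.toEndAlgebra isOfCMType_of_isField
  nontrivial_endAlgebra_of_dim_pos)
open Literature.AlgebraicGeometry.Milne1999 (IsOfCMType)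
open Literature.NumberTheory.Automorphic (IsQuaternionAlgebra)
open Literature.RingTheory.CentralSimple

variable [HodgeTensorFacts.{0, 0}]

/-- **The Mumford–Tate rank of a simple abelian surface, by endomorphism type.**  For a simple complex abelian surface `B` with
`t = dim MT(H¹B)`: EITHER `End⁰B = ℚ` and `t ∈ {7, 11}`, OR `dim_ℚ End⁰B = 2` and `t = 7`, OR `dim_ℚ End⁰B = 4`, `End⁰B` commutative,
`B` of CM type and `t = 3`, OR `dim_ℚ End⁰B = 4`, `End⁰B` non-commutative and `t = 4`. [cite: MoonenZarhin1999LowDim, §2 (2.2)]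
[cite: Ribet1983, Thm. 0–1] [cite: MumfordAV1970, §19 Cor. 2 and §21] -/
theorem mtRank_hodge_one_of_isSimple_surface {B : AbelianVariety ℂ} {k : ℕ} (hB : IsSmoothProjective k B.X) (hBs : B.IsSimple)
    (hB2 : B.dim = 2) :
    haveI := BettiUniverse.finite hB 1
    (Module.finrank ℚ B.endAlgebra = 1 ∧ ((BettiUniverse.hodge exists_isReal_hodgeModel_holds hB 1).mtRank = 7 ∨
        (BettiUniverse.hodge exists_isReal_hodgeModel_holds hB 1).mtRank = 11)) ∨
      (Module.finrank ℚ B.endAlgebra = 2 ∧ (BettiUniverse.hodge exists_isReal_hodgeModel_holds hB 1).mtRank = 7) ∨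
      (Module.finrank ℚ B.endAlgebra = 4 ∧ (∀ x y : B.endAlgebra, x * y = y * x) ∧ IsOfCMType B ∧
        (BettiUniverse.hodge exists_isReal_hodgeModel_holds hB 1).mtRank = 3) ∨
      (Module.finrank ℚ B.endAlgebra = 4 ∧ (∃ x y : B.endAlgebra, x * y ≠ y * x) ∧
        (BettiUniverse.hodge exists_isReal_hodgeModel_holds hB 1).mtRank = 4) := by
  classical
  have hk : B.dim = k := schemeDim_eq_holds hB
  subst hk
  haveI := BettiUniverse.finite hB 1
  have h0 : 0 < B.dim := by omega
  rcases AbelianVariety.finrank_endAlgebra_eq_of_isSimple_surface hBs hB2 with h1 | h2 | h4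
  · -- type I(1)
    exact Or.inl ⟨h1, mtRank_hodge_one_eq_seven_or_eleven_of_surface_of_finrank_endAlgebra_eq_one hB hB2 h1⟩
  · -- type I(2): a real quadratic field, Ribet's `t = 3 dim B + 1`
    have hF : IsField B.endAlgebra := AbelianVariety.isField_endAlgebra_of_isSimple_of_finrank_eq_two hBs h0 h2
    haveI : IsTotallyReal (EndField B hF) := AbelianVariety.isTotallyReal_endField_of_surface hB2 h2 hF
    have h7 := (mtRank_hodge_one_of_isTotallyReal' hF hB (by rw [h2, hB2])).1
    exact Or.inr (Or.inl ⟨h2, by omega⟩)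
  · by_cases hc : ∀ x y : B.endAlgebra, x * y = y * x
    · -- type IV(2,1): a quartic CM field
      have hF : IsField B.endAlgebra := AbelianVariety.isField_endAlgebra_of_isSimple_of_comm hBs h0 hc
      have hFtop : IsField (⊤ : Subalgebra ℚ B.endAlgebra) :=
        MulEquiv.isField hF (Subalgebra.topEquiv : (⊤ : Subalgebra ℚ B.endAlgebra) ≃ₐ[ℚ] B.endAlgebra).toMulEquiv
      have hdeg : Module.finrank ℚ (⊤ : Subalgebra ℚ B.endAlgebra) = 2 * B.dim := by
        rw [← Subalgebra.finrank_toSubmodule, Algebra.top_toSubmodule, finrank_top, h4, hB2]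
      have hcm : IsOfCMType B := isOfCMType_of_isField ⊤ hFtop hdeg
      have h3 := mtRank_hodge_one_eq_three_of_isIsogenous_powSucc_surface hB hBs hB2 hcm (N := 0) (IsIsogenous.refl B)
      exact Or.inr (Or.inr (Or.inl ⟨h4, hc, hcm, h3⟩))
    · -- type II(1): an indefinite quaternion algebra over `ℚ` (type III(1) does not occur)
      push Not at hc
      obtain ⟨x, y, hxy⟩ := hc
      haveI : IsQuaternionAlgebra ℚ B.endAlgebra := AbelianVariety.isQuaternionAlgebra_endAlgebra_of_isSimple hBs h0 h4 ⟨x, y, hxy⟩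
      have hind : IsTotallyIndefinite ℚ B.endAlgebra :=
        AbelianVariety.isTotallyIndefinite_of_isSimple_of_dim_eq (K := ℚ) hBs (by rw [Module.finrank_self, hB2])
      have hle := mtRank_hodge_one_le_of_isTotallyIndefinite hB hBs one_pos (m := 1) (by rw [hB2]) hind
      have hA4 : HasNoTypeIVFactor B := AbelianVariety.hasNoTypeIVFactor_of_isTotallyReal (K := ℚ)
      have hcm : ¬ IsOfCMType B := not_isOfCMType_of_hasNoTypeIVFactor hB h0 hA4
      have hge := four_le_mtRank_hodge_one_of_not_isOfCMType hB hcm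
      exact Or.inr (Or.inr (Or.inr ⟨h4, ⟨x, y, hxy⟩, by omega⟩))

/-- **`t(B) ∈ {3, 4, 7, 11}` for every simple complex abelian surface `B`.** [cite: MoonenZarhin1999LowDim, §2 (2.2)]
[cite: Ribet1983, Thm. 0–1] -/
theorem mtRank_hodge_one_mem_of_isSimple_surface {B : AbelianVariety ℂ} {k : ℕ} (hB : IsSmoothProjective k B.X)
    (hBs : B.IsSimple) (hB2 : B.dim = 2) :
    haveI := BettiUniverse.finite hB 1
    (BettiUniverse.hodge exists_isReal_hodgeModel_holds hB 1).mtRank = 3 ∨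
      (BettiUniverse.hodge exists_isReal_hodgeModel_holds hB 1).mtRank = 4 ∨
      (BettiUniverse.hodge exists_isReal_hodgeModel_holds hB 1).mtRank = 7 ∨
      (BettiUniverse.hodge exists_isReal_hodgeModel_holds hB 1).mtRank = 11 := by
  rcases mtRank_hodge_one_of_isSimple_surface hB hBs hB2 with ⟨-, h | h⟩ | ⟨-, h⟩ | ⟨-, -, -, h⟩ | ⟨-, -, h⟩
  · exact Or.inr (Or.inr (Or.inl h))
  · exact Or.inr (Or.inr (Or.inr h))
  · exact Or.inr (Or.inr (Or.inl h))
  · exact Or.inl h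
  · exact Or.inr (Or.inl h)

/-- **A simple abelian surface is of CM type iff `t = 3`.** [cite: MoonenZarhin1999LowDim, §2 (2.2)] -/
theorem isOfCMType_iff_mtRank_hodge_one_eq_three_of_isSimple_surface {B : AbelianVariety ℂ} {k : ℕ}
    (hB : IsSmoothProjective k B.X) (hBs : B.IsSimple) (hB2 : B.dim = 2) :
    haveI := BettiUniverse.finite hB 1
    IsOfCMType B ↔ (BettiUniverse.hodge exists_isReal_hodgeModel_holds hB 1).mtRank = 3 := by
  haveI := BettiUniverse.finite hB 1
  refine ⟨fun hcm => ?_, fun h3 => isOfCMType_of_mtRank_hodge_one_eq_three hB h3⟩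
  have hle := mtRank_hodge_one_le_dim_add_one_of_isOfCMType hB (by omega) hcm
  rw [hB2] at hle
  rcases mtRank_hodge_one_mem_of_isSimple_surface hB hBs hB2 with h | h | h | h <;> omega

/-- **A simple abelian surface has non-commutative endomorphism algebra (quaternionic multiplication) iff `t = 4`.**
[cite: MoonenZarhin1999LowDim, §2 (2.2)] -/
theorem exists_mul_ne_iff_mtRank_hodge_one_eq_four_of_isSimple_surface {B : AbelianVariety ℂ} {k : ℕ}
    (hB : IsSmoothProjective k B.X) (hBs : B.IsSimple) (hB2 : B.dim = 2) :
    haveI := BettiUniverse.finite hB 1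
    (∃ x y : B.endAlgebra, x * y ≠ y * x) ↔ (BettiUniverse.hodge exists_isReal_hodgeModel_holds hB 1).mtRank = 4 := by
  haveI := BettiUniverse.finite hB 1
  rcases mtRank_hodge_one_of_isSimple_surface hB hBs hB2 with ⟨h1, h⟩ | ⟨h2, h⟩ | ⟨-, hc, -, h⟩ | ⟨-, hnc, h⟩
  · -- `End⁰B = ℚ` is commutative and `t ∈ {7, 11}`
    refine ⟨fun ⟨x, y, hxy⟩ => ?_, fun h4 => by omega⟩
    haveI : Nontrivial B.endAlgebra := nontrivial_endAlgebra_of_dim_pos (by omega)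
    have hbt : (⊥ : Subalgebra ℚ B.endAlgebra) = ⊤ := Subalgebra.bot_eq_top_iff_finrank_eq_one.2 h1
    obtain ⟨a, ha⟩ := Algebra.mem_bot.1 ((hbt.symm ▸ Algebra.mem_top : x ∈ (⊥ : Subalgebra ℚ B.endAlgebra)))
    exact absurd (by rw [← ha]; exact Algebra.commutes a y) hxy
  · refine ⟨fun ⟨x, y, hxy⟩ => ?_, fun h4 => by omega⟩
    exact absurd ((AbelianVariety.isField_endAlgebra_of_isSimple_of_finrank_eq_two hBs (by omega) h2).mul_comm x y) hxy
  · exact ⟨fun ⟨x, y, hxy⟩ => absurd (hc x y) hxy, fun h4 => by omega⟩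
  · exact ⟨fun _ => h, fun _ => hnc⟩

end Summit.HodgeConjecture.CorCM

end
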